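import Literature.Computability.Complexity.CircuitEvalPrograms
import Literature.Computability.Complexity.CircuitSizeProofs
import Literature.Computability.Complexity.FPStringBricks
import Literature.Computability.Complexity.StackBricksStrings
import Literature.Computability.Complexity.StackWordArith
import Literature.Computability.Complexity.TruthTableClosure
import Literature.Computability.Complexity.PairPlumbing
import Literature.Computability.MetaComplexity.MCSP
import HarnessLib

/-!
# `MCSP ∈ NP` (proofs; trunk CplxMeta)

This file DISCHARGES the named fact `Literature.Computability.MetaComplexity.MCSP_mem_NP` (`MCSP.lean`; Kabanets–Cai 2000,
§2: "MCSP is clearly in NP"; Murray–Williams 2015, §1: "MCSP is in NP, because any circuit of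
size at most `k` could be guessed nondeterministically in `O(k log k) ≤ O(n)` time, then verified
on all bits of the truth table `T` in `poly(2^ℓ, k) ≤ poly(n)` time", with footnote 1: every
function has a circuit of size `O(2^ℓ ℓ)`, so w.l.o.g. `k` is small): `MCSP_mem_NP_holds`.

In the tree `NP = polyExists P` (certificates, `Nondeterministic.lean`), so a proof consists of a
verifier language `Ver ∈ P` and a witness-length polynomial. The certificate for an instance
`⟨tt f, bin s⟩` is `⟨1ⁿ, D⟩`: the arity `n` in unary and a *program* `D` of the circuit-evaluation
machine of `CircuitEval.lean` (`CircEval.evalFn ∈ FP`) — the program `CircEval.progOf C` of an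
optimal circuit `C`, or, for the projections (the functions of circuit complexity `0`), a bare
rotation code `CircEval.rotCode k`. The verifier is assembled in the tree's algebra of `FP`
string functions and `P` languages (no machine is programmed here):

* `WF`, `CANON`: the instance is a pair `⟨tt, sb⟩` with `sb` a canonical numeral
  (`norm`, `StackBricks.lean`);
* `POW`: `|tt| = 2ⁿ` (`binToUnaryFn` of `FPStringBricks.lean` on the numeral `bin (2ⁿ)` obtained
  as `addFn ⟨1ⁿ, bin 1⟩`);
* `CLEAN`: `D` parses into whole instructions (the transducer `cleanT`);
* `MAIN = ballLang X ROW` (`TruthTableClosure.lean`, `P` is closed under polynomially bounded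
  `∀`): for every `i < |z|`, either `i ≥ |tt|` or the bit `tt[i]` (`bitAtFn`) equals the answer
  of the evaluator on `⟨u, D⟩`, `u` the `n` low bits of `i` (`padTakeFn` of
  `StackBricksStrings.lean` applied to `bin i = unToBinFn 1ⁱ`), which is the `i`-th point of the
  cube in the order of `boolFunEquivFin` (`boolFunEquivFin_symm_apply`);
* `SIZE`: `#TAB(D) ≤ s` and `s ≠ 0` (the transducer `tabMarksT` emitting `1^{#TAB D}`, then
  `unLeBinFn` of `UnaryLeBinary.lean`), or `PROJ`: `D = (11)ᵏ` with `k < n`.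

Soundness (`sound`) is Theorem R of `CircuitEvalPrograms.lean` (`exists_circuit_evalFn`: a clean
program computes a function of `B₂`-complexity `≤ max (#TAB) 1`) and `vmSpec_rotCode_proj`
(rotation codes compute projections, of complexity `0`); completeness (`complete`) takes an optimal
circuit (`exists_circuit_size_eq_circuitSizeOver`, of size `≤ univBound n < 3 |x|` by
`cktSize_univ_fin`, which makes the certificate polynomially short — Murray–Williams' footnote) and
`vmSpec_progOf`.

## References

* V. Kabanets, J.-Y. Cai, *Circuit minimization problem*, STOC 2000, 73–79, §2 (MCSP ∈ NP).
* C. D. Murray, R. R. Williams, *On the (non) NP-hardness of computing circuit complexity*,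
  CCC 2015, LIPIcs 33, 365–380, §1 p. 365 and footnote 1 (the NP verifier; every function has
  circuits of size `O(2ⁿ n)`).
* S. Arora, B. Barak, *Computational Complexity: A Modern Approach*, CUP 2009, Def. 2.1 (NP via
  certificates), Rem. 6.4, Ex. 6.6.
-/

namespace Literature.Computability.MetaComplexity

open _root_.Computability Complexity Complexity.Classes Complexity.CircEval Complexity.Brick

namespace MCSPVerif

/-! ### Two transducers on programs of the evaluation machine -/

/-- Parser states for programs of the value-stack machine of `CircuitEval.lean`: at an
instruction boundary (`op0`), after a first opcode bit (`op1 c`), or inside a `TAB` with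
`4, 3, 2, 1` table bits still to be read. [folklore] -/
inductive PS
  | op0
  | op1 (c : Bool)
  | t4
  | t3
  | t2
  | t1
  deriving DecidableEq, Fintype

/-- The parser transition (`11 = ROT`, `10 = BACK`, `01 = READ`, `00 t₀ t₁ t₂ t₃ = TAB`), emitting
one mark `1` per `TAB` opcode. [folklore] -/
def psStep : PS → Bool → PS × List Bool
  | .op0, c => (.op1 c, [])
  | .op1 true, _ => (.op0, [])
  | .op1 false, true => (.op0, [])
  | .op1 false, false => (.t4, [true])
  | .t4, _ => (.t3, [])
  | .t3, _ => (.t2, [])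
  | .t2, _ => (.t1, [])
  | .t1, _ => (.op0, [])

/-- `tabMarksT`: the transducer emitting `1^{#TAB D}`, the number of table instructions of a
program in unary (`tabMarksT_eval`). [folklore] -/
def tabMarksT : FST PS Bool Bool where
  init := .op0
  step := psStep
  front := fun _ => []
  keep := fun _ => true

/-- `cleanT`: the transducer answering `[isClean D]` — a program is clean iff its parse ends at
an instruction boundary (`cleanT_eval`). [folklore] -/
def cleanT : FST PS Bool Bool where
  init := .op0
  step := psStep
  front := fun s => [decide (s = PS.op0)]
  keep := fun _ => false

/-- The transition of `tabMarksT` (definitional). [folklore] -/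
@[simp] theorem tabMarksT_step (s : PS) (b : Bool) : tabMarksT.step s b = psStep s b := rfl

/-- The transition of `cleanT` (definitional). [folklore] -/
@[simp] theorem cleanT_step (s : PS) (b : Bool) : cleanT.step s b = psStep s b := rfl

/-- Both transducers have the same runs. [folklore] -/
theorem cleanT_run (s : PS) (D : List Bool) : cleanT.run s D = tabMarksT.run s D := by
  induction D generalizing s with
  | nil => rfl
  | cons b D ih => simp [FST.run_cons, ih]

/-- Four table bits are skipped silently. [folklore] -/
theorem run_t4_long (a b c d : Bool) (D : List Bool) :
    tabMarksT.run .t4 (a :: b :: c :: d :: D) = tabMarksT.run .op0 D := by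
  simp [FST.run_cons, psStep]

/-- A truncated table: the parse does not end at a boundary and nothing more is emitted. [folklore] -/
theorem run_t4_short (D : List Bool) (hD : D.length < 4) :
    (tabMarksT.run .t4 D).1 ≠ .op0 ∧ (tabMarksT.run .t4 D).2 = [] := by
  rcases D with _ | ⟨a, _ | ⟨b, _ | ⟨c, _ | ⟨d, D⟩⟩⟩⟩
  · simp
  · simp [FST.run_cons, psStep]
  · simp [FST.run_cons, psStep]
  · simp [FST.run_cons, psStep]
  · exact absurd hD (by simp)

/-- **The parse of a program**: the marks emitted are `1^{#TAB D}` and the parse ends at an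
instruction boundary iff the program is clean (same recursion as `tabCount`/`isClean`). [folklore] -/
theorem run_op0 : ∀ (N : ℕ) (D : List Bool), D.length ≤ N →
    (tabMarksT.run .op0 D).2 = ones (tabCount D) ∧
      ((tabMarksT.run .op0 D).1 = .op0 ↔ isClean D = true)
  | N, [], _ => by simp [ones]
  | N, [c], _ => by simp [FST.run_cons, psStep, ones]
  | 0, _ :: _ :: _, hN => by simp at hN
  | N + 1, true :: c :: D, hN => by
    have ih := run_op0 N D (by simp at hN; omega)
    simpa [FST.run_cons, psStep] using ih
  | N + 1, false :: true :: D, hN => by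
    have ih := run_op0 N D (by simp at hN; omega)
    simpa [FST.run_cons, psStep] using ih
  | N + 1, false :: false :: D, hN => by
    by_cases h4 : 4 ≤ D.length
    · obtain ⟨a, b, c, d, D', rfl⟩ : ∃ a b c d D', D = a :: b :: c :: d :: D' := by
        rcases D with _ | ⟨a, _ | ⟨b, _ | ⟨c, _ | ⟨d, D'⟩⟩⟩⟩ <;> simp at h4
        exact ⟨a, b, c, d, D', rfl⟩
      have ih := run_op0 N D' (by simp at hN; omega)
      simp only [FST.run_cons, tabMarksT_step, psStep, List.nil_append, List.singleton_append,
        tabCount_ff, isClean_ff, List.length_cons, List.drop_succ_cons, List.drop_zero]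
      refine ⟨?_, ?_⟩
      · rw [ih.1]; rfl
      · rw [ih.2]; simp
    · have hs := run_t4_short D (by omega)
      simp only [FST.run_cons, tabMarksT_step, psStep, List.nil_append, List.singleton_append,
        tabCount_ff, isClean_ff, List.drop_of_length_le (show D.length ≤ 4 by omega), tabCount_nil,
        hs.2]
      refine ⟨rfl, ?_⟩
      simp only [hs.1, false_iff, Bool.and_eq_true, decide_eq_true_eq, not_and]
      intro h; omega

/-- **`tabMarksT.eval D = 1^{#TAB D}`.** [folklore] -/
theorem tabMarksT_eval (D : List Bool) : tabMarksT.eval D = ones (tabCount D) := by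
  have h := (run_op0 D.length D le_rfl).1
  unfold FST.eval
  rw [show tabMarksT.init = PS.op0 from rfl, h]
  simp [tabMarksT]

/-- **`cleanT.eval D = [isClean D]`.** [folklore] -/
theorem cleanT_eval (D : List Bool) : cleanT.eval D = [isClean D] := by
  have h := (run_op0 D.length D le_rfl).2
  unfold FST.eval
  rw [show cleanT.init = PS.op0 from rfl, cleanT_run]
  simp only [cleanT, Bool.false_eq_true, ↓reduceIte, List.append_nil, List.cons.injEq, and_true]
  cases hc : isClean D
  · rw [hc] at h; simpa using h
  · exact decide_eq_true (h.2 hc)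

/-- `tabMarksT.eval ∈ FP`. [folklore] -/
theorem tabMarksT_mem_FP : tabMarksT.eval ∈ FP := tabMarksT.polyTimeComputable_eval

/-- `cleanT.eval ∈ FP`. [folklore] -/
theorem cleanT_mem_FP : cleanT.eval ∈ FP := cleanT.polyTimeComputable_eval

/-! ### Unary to binary -/

/-- `⟦1ᵐ⟧ = 2ᵐ - 1`. [folklore] -/
theorem bitsToNat_ones (m : ℕ) : bitsToNat (ones m) = 2 ^ m - 1 := by
  induction m with
  | zero => rfl
  | succ m ih =>
    rw [show ones (m + 1) = true :: ones m from rfl, bitsToNat_cons, ih, pow_succ]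
    have := Nat.one_le_two_pow (n := m)
    simp; omega

/-- The initial conversion state `⟨w, ⟨1^{|w|}, ⟨bin 0, 1⁰⟩⟩⟩` (ruler, cap, counter, accumulator, in
the format of `cvRound` of `FPStringBricks.lean`). [folklore] -/
noncomputable def ubInit : List Bool → List Bool :=
  fanoutFn id (fanoutFn onesFn (fun _ => boolPair [] []))

/-- **Unary to binary**: `unToBinFn w = bin |w|` — `|w|` rounds of the counting round `cvRound`
(increment the binary counter while below the cap `⟦1^{|w|}⟧ = 2^{|w|} - 1 ≥ |w|`), then the
counter field. [Arora–Barak 2009, §1.3 (conversions between unary and binary)] [folklore] -/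
noncomputable def unToBinFn : List Bool → List Bool :=
  cvC ∘ (fun w => cvRound^[(Polynomial.X : Polynomial ℕ).eval (boolUnpair w).1.length] w) ∘ ubInit

/-- **`unToBinFn w = encodeNat |w|`.** [folklore] -/
@[simp] theorem unToBinFn_apply (w : List Bool) : unToBinFn w = encodeNat w.length := by
  have h0 : ubInit w = boolPair w (boolPair (ones w.length) (boolPair (encodeNat 0) (ones 0))) := by
    simp [ubInit, fanoutFn_apply, onesFn, OracleCompose.unaryEncodeNat_eq_replicate, ones]
    rfl
  have hle : w.length ≤ bitsToNat (ones w.length) := by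
    rw [bitsToNat_ones]
    have := Nat.lt_two_pow_self (n := w.length)
    omega
  simp only [unToBinFn, Function.comp_apply, h0, boolUnpair_boolPair, Polynomial.eval_X]
  rw [iterate_cvRound _ _ _ 0 (Nat.zero_le _), Nat.zero_add, Nat.min_eq_left hle]
  simp [cvC, fstP, sndP]

/-- **`unToBinFn ∈ FP`** (clocked iteration `iterate_mem_FP` of `cvRound`). [Arora–Barak 2009,
§1.3, §1.4.1] [cite: AroraBarakCC2009, §1.4.1] -/
theorem unToBinFn_mem_FP : unToBinFn ∈ FP :=
  comp_mem_FP cvC_mem_FP (comp_mem_FP (iterate_mem_FP cvRound_mem_FP 12 length_cvRound_le Polynomial.X)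
    (fanoutFn_mem_FP OracleCompose.id_mem_FP (fanoutFn_mem_FP onesFn_mem_FP (const_mem_FP _))))

/-! ### The order of the cube -/

/-- The `n` low binary digits of `i`, least significant first, as a point of the cube `{0,1}ⁿ`.
[cite: KabanetsCai2000, §2] -/
def lowBits (n i : ℕ) : Fin n → Bool := fun k => (encodeNat i).getD k false

/-- The digits are the bits of `i`. [folklore] -/
theorem lowBits_apply (n i : ℕ) (k : Fin n) : lowBits n i k = i.testBit k := by
  rw [lowBits, ← Com.testBit_bitsToNat, bitsToNat_encodeNat]

/-- **The `i`-th point of the cube in the order of `boolFunEquivFin` is `lowBits n i`** (the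
truth table lists `f` at `0, 1, …, 2ⁿ - 1` read in binary, least significant bit = variable `0`).
[cite: KabanetsCai2000, §2] -/
theorem boolFunEquivFin_symm_apply (n : ℕ) (i : Fin (2 ^ n)) :
    (boolFunEquivFin n).symm i = lowBits n i := by
  funext k
  rw [lowBits_apply, Nat.testBit_eq_decide_div_mod_eq]
  simp only [boolFunEquivFin, Equiv.symm_trans_apply, Equiv.arrowCongr_symm, Equiv.symm_symm,
    Equiv.arrowCongr_apply, Equiv.coe_refl, Function.comp_apply, id_eq]
  have hv := finFunctionFinEquiv_symm_apply_val i k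
  generalize finFunctionFinEquiv.symm i k = d at hv
  revert hv
  refine Fin.cases ?_ (fun j => ?_) d
  · intro hv; simp at hv; simp [finTwoEquiv]; omega
  · intro hv
    have hj : j = 0 := Subsingleton.elim _ _
    subst hj
    simp at hv; simp [finTwoEquiv]; omega

/-- The padded low digits of the numeral of `i` list the point `lowBits n i`. [folklore] -/
theorem takeD_encodeNat (n i : ℕ) : (encodeNat i).takeD n false = List.ofFn (lowBits n i) := by
  apply List.ext_getElem
  · simp [List.takeD_length]
  · intro k h1 h2
    rw [List.takeD_length] at h1
    rw [List.getElem_ofFn, ← List.getD_eq_getElem _ false, getD_takeD n _ k h1]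
    rfl

/-- The `i`-th bit of a truth table is the value at the `i`-th point. [cite: KabanetsCai2000, §2] -/
theorem getElem_truthTable {n : ℕ} (f : (Fin n → Bool) → Bool) (i : ℕ) (hi : i < (truthTable f).length) :
    (truthTable f)[i] = f (lowBits n i) := by
  have hi' : i < 2 ^ n := by simpa using hi
  simp only [truthTable, List.getElem_ofFn]
  rw [boolFunEquivFin_symm_apply]

/-! ### The verifier language -/

/-- The truth-table field `tt` of `z = ⟨⟨tt, sb⟩, y⟩`. [folklore] -/
def ttF : List Bool → List Bool := fstP ∘ fstP
/-- The size field `sb` of `z = ⟨⟨tt, sb⟩, y⟩`. [folklore] -/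
def sbF : List Bool → List Bool := sndP ∘ fstP
/-- The arity field `ν` of `z = ⟨x, ⟨ν, D⟩⟩`. [folklore] -/
def nuF : List Bool → List Bool := fstP ∘ sndP
/-- The program field `D` of `z = ⟨x, ⟨ν, D⟩⟩`. [folklore] -/
def prF : List Bool → List Bool := sndP ∘ sndP

/-- `ttF ∈ FP`. [folklore] -/
theorem ttF_mem_FP : ttF ∈ FP := comp_mem_FP fstP_mem_FP fstP_mem_FP
/-- `sbF ∈ FP`. [folklore] -/
theorem sbF_mem_FP : sbF ∈ FP := comp_mem_FP sndP_mem_FP fstP_mem_FP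
/-- `nuF ∈ FP`. [folklore] -/
theorem nuF_mem_FP : nuF ∈ FP := comp_mem_FP fstP_mem_FP sndP_mem_FP
/-- `prF ∈ FP`. [folklore] -/
theorem prF_mem_FP : prF ∈ FP := comp_mem_FP sndP_mem_FP sndP_mem_FP

/-- Reading `tt`. [folklore] -/
@[simp] theorem ttF_boolPair (tt sb y : List Bool) : ttF (boolPair (boolPair tt sb) y) = tt := by
  simp [ttF]
/-- Reading `sb`. [folklore] -/
@[simp] theorem sbF_boolPair (tt sb y : List Bool) : sbF (boolPair (boolPair tt sb) y) = sb := by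
  simp [sbF]
/-- Reading `ν`. [folklore] -/
@[simp] theorem nuF_boolPair (x y : List Bool) : nuF (boolPair x y) = fstP y := by simp [nuF]
/-- Reading `D`. [folklore] -/
@[simp] theorem prF_boolPair (x y : List Bool) : prF (boolPair x y) = sndP y := by simp [prF]

/-- Membership in a set-builder language (definitional; `Set.mem_setOf_eq` does not fire on
`Language`-typed goals). Same statement as `StockMachine.memL_setOf` (`StockmeyerMachines.lean`,
whose import cone — approximate counting — is not wanted here); canonical home for both copies:
next to `memL_preimage` in `TruthTableClosure.lean`. [folklore] -/
theorem memL_setOf {p : List Bool → Prop} {w : List Bool} :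
    @Membership.mem (List Bool) (Language Bool) _ {z | p z} w ↔ p w := Iff.rfl

/-- Membership in an intersection of languages (definitional; copy of `StockMachine.memL_inf`, see
`memL_setOf` for the layering reason). [folklore] -/
theorem memL_inf {L₁ L₂ : Language Bool} {w : List Bool} : w ∈ L₁ ⊓ L₂ ↔ w ∈ L₁ ∧ w ∈ L₂ := Iff.rfl

/-- Membership in a union of languages (definitional; copy of `StockMachine.memL_sup`, see
`memL_setOf` for the layering reason). [folklore] -/
theorem memL_sup {L₁ L₂ : Language Bool} {w : List Bool} : w ∈ L₁ ⊔ L₂ ↔ w ∈ L₁ ∨ w ∈ L₂ := Iff.rfl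

/-- `WF`: the instance is a genuine pair `x = ⟨tt, sb⟩`. [folklore] -/
def WF : Language Bool := {z | fstP z = fanoutFn ttF sbF z}

/-- `CANON`: the size field is a canonical numeral (`sb = norm sb = bin ⟦sb⟧`). [folklore] -/
def CANON : Language Bool := {z | sbF z = (norm ∘ sbF) z}

/-- The ruler `1^{min (2^{|ν|}) (|tt| + 1)}` (`binToUnaryFn` on the numeral `bin (2^{|ν|}) =
addFn ⟨1^{|ν|}, bin 1⟩`, capped by `|tt| + 1`). [folklore] -/
noncomputable def powF : List Bool → List Bool :=
  binToUnaryFn ∘ fanoutFn (List.cons true ∘ ttF) (addFn ∘ fanoutFn (onesFn ∘ nuF) (fun _ => encodeNat 1))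

/-- `POW`: `|tt| = 2^{|ν|}` (as `1^{|tt|} = 1^{min (2^{|ν|}) (|tt|+1)}`). [folklore] -/
def POW : Language Bool := {z | (onesFn ∘ ttF) z = powF z}

/-- `CLEAN`: the program `D` is clean. [folklore] -/
def CLEAN : Language Bool := {z | (cleanT.eval ∘ prF) z = (fun _ => [true]) z}

/-- On a row `w = ⟨z, 1ⁱ⟩`: the bit `tt[i]` (`[]` if `i ≥ |tt|`). [folklore] -/
noncomputable def bitF : List Bool → List Bool := bitAtFn ∘ fanoutFn sndP (ttF ∘ fstP)

/-- On a row `w = ⟨z, 1ⁱ⟩`: the input `u = ` the `|ν|` low bits of `i`. [folklore] -/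
noncomputable def argF : List Bool → List Bool :=
  fstP ∘ padTakeFn ∘ fanoutFn (nuF ∘ fstP) (unToBinFn ∘ sndP)

/-- On a row `w = ⟨z, 1ⁱ⟩`: the evaluator's answer on `⟨u, D⟩`. [cite: AroraBarakCC2009, Thm. 6.18 (proof)] -/
noncomputable def ansF : List Bool → List Bool := evalFn ∘ fanoutFn argF (prF ∘ fstP)

/-- `ROW`: the row `⟨z, 1ⁱ⟩` is consistent — `i ≥ |tt|`, or `tt[i]` is the answer of `D` on the
`i`-th point. [cite: MurrayWilliams2015, §1 p. 365] -/
def ROW : Language Bool := {w | bitF w = (fun _ => []) w} ⊔ {w | bitF w = ansF w}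

/-- `MAIN`: all rows `i < |z|` are consistent ("verified on all bits of the truth table").
[cite: MurrayWilliams2015, §1 p. 365] -/
def MAIN : Language Bool := ballLang Polynomial.X ROW

/-- The size test `[#TAB D ≤ ⟦sb⟧]` (`unLeBinFn ⟨1^{#TAB D}, sb⟩`). [folklore] -/
noncomputable def sizeF : List Bool → List Bool := unLeBinFn ∘ fanoutFn (tabMarksT.eval ∘ prF) sbF

/-- `SIZE`: `#TAB D ≤ s` and `s ≠ 0`. [cite: MurrayWilliams2015, §1 p. 365] -/
def SIZE : Language Bool :=
  {z | sizeF z = (fun _ => [true]) z} ⊓ {z | (isNilFn ∘ sbF) z = (fun _ => [false]) z}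

/-- `PROJ`: `D = (11)ᵏ` is a bare rotation code with `|D| < 2 |ν|` (certificate of a projection).
[folklore] -/
def PROJ : Language Bool :=
  {z | prF z = (onesFn ∘ prF) z} ⊓ fanoutFn nuF prF ⁻¹' LenLt (2 * Polynomial.X)

/-- **The verifier language of `MCSP`.** [cite: KabanetsCai2000, §2] -/
def Ver : Language Bool := WF ⊓ CANON ⊓ POW ⊓ CLEAN ⊓ MAIN ⊓ (SIZE ⊔ PROJ)

/-! ### The verifier is polynomial time -/

/-- `WF ∈ P`. [folklore] -/
theorem WF_mem_P : WF ∈ P := setOf_apply_eq_apply_mem_P fstP_mem_FP (fanoutFn_mem_FP ttF_mem_FP sbF_mem_FP)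

/-- `CANON ∈ P`. [folklore] -/
theorem CANON_mem_P : CANON ∈ P := setOf_apply_eq_apply_mem_P sbF_mem_FP (comp_mem_FP norm_mem_FP sbF_mem_FP)

/-- `powF ∈ FP`. [folklore] -/
theorem powF_mem_FP : powF ∈ FP :=
  comp_mem_FP binToUnaryFn_mem_FP (fanoutFn_mem_FP (comp_mem_FP (cons_mem_FP true) ttF_mem_FP)
    (comp_mem_FP addFn_mem_FP (fanoutFn_mem_FP (comp_mem_FP onesFn_mem_FP nuF_mem_FP) (const_mem_FP _))))

/-- `POW ∈ P`. [folklore] -/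
theorem POW_mem_P : POW ∈ P := setOf_apply_eq_apply_mem_P (comp_mem_FP onesFn_mem_FP ttF_mem_FP) powF_mem_FP

/-- `CLEAN ∈ P`. [folklore] -/
theorem CLEAN_mem_P : CLEAN ∈ P :=
  setOf_apply_eq_apply_mem_P (comp_mem_FP cleanT_mem_FP prF_mem_FP) (const_mem_FP _)

/-- `bitF ∈ FP`. [folklore] -/
theorem bitF_mem_FP : bitF ∈ FP :=
  comp_mem_FP bitAtFn_mem_FP (fanoutFn_mem_FP sndP_mem_FP (comp_mem_FP ttF_mem_FP fstP_mem_FP))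

/-- `argF ∈ FP`. [folklore] -/
theorem argF_mem_FP : argF ∈ FP :=
  comp_mem_FP fstP_mem_FP (comp_mem_FP padTakeFn_mem_FP
    (fanoutFn_mem_FP (comp_mem_FP nuF_mem_FP fstP_mem_FP) (comp_mem_FP unToBinFn_mem_FP sndP_mem_FP)))

/-- `ansF ∈ FP`. [cite: AroraBarakCC2009, Thm. 6.18 (proof: "CKT-EVAL ∈ P")] -/
theorem ansF_mem_FP : ansF ∈ FP :=
  comp_mem_FP evalFn_mem_FP (fanoutFn_mem_FP argF_mem_FP (comp_mem_FP prF_mem_FP fstP_mem_FP))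

/-- `ROW ∈ P`. [folklore] -/
theorem ROW_mem_P : ROW ∈ P :=
  union_mem_P (setOf_apply_eq_apply_mem_P bitF_mem_FP (const_mem_FP _))
    (setOf_apply_eq_apply_mem_P bitF_mem_FP ansF_mem_FP)

/-- `MAIN ∈ P` (`P` is closed under polynomially bounded `∀`). [Arora–Barak 2009, §1.3] [folklore] -/
theorem MAIN_mem_P : MAIN ∈ P := ballLang_mem_P _ ROW_mem_P

/-- `sizeF ∈ FP`. [folklore] -/
theorem sizeF_mem_FP : sizeF ∈ FP :=
  comp_mem_FP unLeBinFn_mem_FP (fanoutFn_mem_FP (comp_mem_FP tabMarksT_mem_FP prF_mem_FP) sbF_mem_FP)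

/-- `SIZE ∈ P`. [folklore] -/
theorem SIZE_mem_P : SIZE ∈ P :=
  inter_mem_P (setOf_apply_eq_apply_mem_P sizeF_mem_FP (const_mem_FP _))
    (setOf_apply_eq_apply_mem_P (comp_mem_FP isNilFn_mem_FP sbF_mem_FP) (const_mem_FP _))

/-- `PROJ ∈ P`. [folklore] -/
theorem PROJ_mem_P : PROJ ∈ P :=
  inter_mem_P (setOf_apply_eq_apply_mem_P prF_mem_FP (comp_mem_FP onesFn_mem_FP prF_mem_FP))
    (preimage_mem_P (LenLt_mem_P _) (fanoutFn_mem_FP nuF_mem_FP prF_mem_FP))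

/-- **The verifier language is in `P`.** [cite: KabanetsCai2000, §2] -/
theorem Ver_mem_P : Ver ∈ P :=
  inter_mem_P (inter_mem_P (inter_mem_P (inter_mem_P (inter_mem_P WF_mem_P CANON_mem_P) POW_mem_P)
    CLEAN_mem_P) MAIN_mem_P) (union_mem_P SIZE_mem_P PROJ_mem_P)

/-! ### Reading the conditions on a pair `z = ⟨⟨tt, sb⟩, y⟩` -/

section Reading

variable (tt sb y : List Bool)

/-- `⟦0ᵐ 1⟧`-free form: the numeral built by `powF` has value `2^{|ν|}`. [folklore] -/
theorem powF_boolPair : powF (boolPair (boolPair tt sb) y) =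
    ones (min (2 ^ (fstP y).length) (tt.length + 1)) := by
  simp only [powF, Function.comp_apply, fanoutFn_apply, ttF_boolPair, nuF_boolPair, addFn_boolPair,
    bitsToNat_encodeNat, binToUnaryFn_boolPair, List.length_cons, onesFn,
    OracleCompose.unaryEncodeNat_eq_replicate]
  rw [show List.replicate (fstP y).length true = ones (fstP y).length from rfl, bitsToNat_ones]
  have := Nat.one_le_two_pow (n := (fstP y).length)
  congr 1; omega

/-- `z ∈ POW ↔ |tt| = 2^{|ν|}`. [folklore] -/
theorem mem_POW_iff : boolPair (boolPair tt sb) y ∈ POW ↔ tt.length = 2 ^ (fstP y).length := by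
  rw [POW, memL_setOf, powF_boolPair, Function.comp_apply, ttF_boolPair, onesFn, OracleCompose.unaryEncodeNat_eq_replicate]
  constructor
  · intro h
    have hl := congrArg List.length h
    simp [ones] at hl
    omega
  · intro h
    rw [show min (2 ^ (fstP y).length) (tt.length + 1) = tt.length by omega]

/-- `z ∈ CANON ↔ sb = bin ⟦sb⟧`. [folklore] -/
theorem mem_CANON_iff : boolPair (boolPair tt sb) y ∈ CANON ↔ sb = encodeNat (bitsToNat sb) := by
  rw [CANON, memL_setOf, Function.comp_apply, sbF_boolPair, norm_eq_encodeNat]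

/-- `z ∈ CLEAN ↔ isClean D`. [folklore] -/
theorem mem_CLEAN_iff : boolPair (boolPair tt sb) y ∈ CLEAN ↔ isClean (sndP y) = true := by
  rw [CLEAN, memL_setOf, Function.comp_apply, prF_boolPair, cleanT_eval]
  simp

/-- `z ∈ SIZE ↔ #TAB D ≤ ⟦sb⟧ ∧ sb ≠ []`, for a canonical `sb`. [folklore] -/
theorem mem_SIZE_iff (s : ℕ) (hsb : sb = encodeNat s) :
    boolPair (boolPair tt sb) y ∈ SIZE ↔ tabCount (sndP y) ≤ s ∧ s ≠ 0 := by
  rw [SIZE, memL_inf, memL_setOf, memL_setOf]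
  simp only [sizeF, Function.comp_apply, fanoutFn_apply, prF_boolPair, sbF_boolPair, tabMarksT_eval,
    hsb, unLeBinFn_boolPair, isNilFn, List.cons.injEq, and_true, decide_eq_true_eq,
    decide_eq_false_iff_not]
  simp only [ones, List.length_replicate]
  rw [show encodeNat s = [] ↔ s = 0 from
    ⟨fun h => by simpa [h] using (bitsToNat_encodeNat s).symm, fun h => by subst h; rfl⟩]

/-- `z ∈ PROJ ↔ D = 1^{|D|} ∧ |D| < 2 |ν|`. [folklore] -/
theorem mem_PROJ_iff : boolPair (boolPair tt sb) y ∈ PROJ ↔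
    sndP y = ones (sndP y).length ∧ (sndP y).length < 2 * (fstP y).length := by
  rw [PROJ, memL_inf, memL_setOf, memL_preimage, Function.comp_apply, prF_boolPair, fanoutFn_apply,
    nuF_boolPair, prF_boolPair, boolPair_mem_LenLt, onesFn, OracleCompose.unaryEncodeNat_eq_replicate]
  simp [ones]

/-- `z ∈ WF ↔ x = ⟨tt, sb⟩` (reading of an arbitrary first component). [folklore] -/
theorem mem_WF_iff (x : List Bool) : boolPair x y ∈ WF ↔ x = boolPair (fstP x) (sndP x) := by
  rw [WF, memL_setOf]
  simp [ttF, sbF, fanoutFn_apply]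

/-- The rows of `MAIN`: `z ∈ MAIN ↔ ∀ i < |z|, ⟨z, 1ⁱ⟩ ∈ ROW`. [folklore] -/
theorem mem_MAIN_iff (z : List Bool) : z ∈ MAIN ↔ ∀ i < z.length, boolPair z (ones i) ∈ ROW := by
  simp [MAIN, ones]

/-- Reading a row: `⟨z, 1ⁱ⟩ ∈ ROW` iff `i ≥ |tt|` or `[tt[i]]` is the evaluator's answer on
`⟨lowBits |ν| i, D⟩`. [cite: MurrayWilliams2015, §1 p. 365] -/
theorem mem_ROW_iff (i : ℕ) : boolPair (boolPair (boolPair tt sb) y) (ones i) ∈ ROW ↔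
    (tt.drop i).take 1 = [] ∨
      (tt.drop i).take 1 = evalFn (boolPair (List.ofFn (lowBits (fstP y).length i)) (sndP y)) := by
  rw [ROW, memL_sup, memL_setOf, memL_setOf]
  simp only [bitF, ansF, argF, Function.comp_apply, fanoutFn_apply, sndP_boolPair, fstP_boolPair,
    ttF_boolPair, nuF_boolPair, prF_boolPair, bitAtFn_boolPair, unToBinFn_apply, padTakeFn_boolPair,
    takeD_encodeNat]
  simp [ones]

end Reading

/-! ### Soundness -/

/-- A clean all-ones program is a rotation code. [folklore] -/
theorem eq_rotCode_of_isClean : ∀ (N : ℕ) (D : List Bool), D.length ≤ N → D = ones D.length →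
    isClean D = true → D = rotCode (D.length / 2)
  | N, [], _, _, _ => by simp [rotCode]
  | N, [c], _, _, h => by simp at h
  | 0, _ :: _ :: _, hN, _, _ => by simp at hN
  | N + 1, a :: b :: D, hN, h1, hc => by
    have ha : a = true := by have := congrArg List.head? h1; simpa [ones, List.replicate_succ] using this
    have hb : b = true := by
      have := congrArg (fun l => l.tail.head?) h1; simpa [ones, List.replicate_succ] using this
    subst ha; subst hb
    have hD : D = ones D.length := by
      have := congrArg (fun l => l.drop 2) h1; simpa [ones, List.replicate_succ] using this
    rw [isClean_tt] at hc
    have ih := eq_rotCode_of_isClean N D (by simp at hN; omega) hD hc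
    rw [show (true :: true :: D).length / 2 = D.length / 2 + 1 by simp; omega, rotCode, ← ih]

/-- **Soundness of the verifier**: an accepted pair `⟨x, y⟩` has `x ∈ MCSP`. From `WF`, `CANON`,
`POW`: `x = ⟨tt f, bin s⟩` for the function `f` tabulated by `tt`; from `CLEAN` and Theorem R
(`exists_circuit_evalFn`) the program computes a function of `B₂`-complexity `≤ max (#TAB D) 1`,
which by `MAIN` (rows `i < 2ⁿ ≤ |z|`, `boolFunEquivFin_symm_apply`) is `f`; `SIZE` bounds this by
`s`, and under `PROJ` the program is a rotation code, `f` a projection (`vmSpec_rotCode_proj`) of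
complexity `0` (`Circuit.input`). [cite: KabanetsCai2000, §2] -/
theorem sound (x y : List Bool) (h : boolPair x y ∈ Ver) : x ∈ MCSP := by
  have hWF : boolPair x y ∈ WF := h.1.1.1.1.1
  have hCANON : boolPair x y ∈ CANON := h.1.1.1.1.2
  have hPOW : boolPair x y ∈ POW := h.1.1.1.2
  have hCLEAN : boolPair x y ∈ CLEAN := h.1.1.2
  have hMAIN : boolPair x y ∈ MAIN := h.1.2
  have hSP : boolPair x y ∈ SIZE ∨ boolPair x y ∈ PROJ := h.2
  clear h
  -- the instance is a pair `⟨tt, sb⟩`; read all conditions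
  obtain ⟨tt, sb, rfl⟩ : ∃ tt sb, x = boolPair tt sb := ⟨_, _, (mem_WF_iff y x).1 hWF⟩
  have hsb := (mem_CANON_iff tt sb y).1 hCANON
  have hlen := (mem_POW_iff tt sb y).1 hPOW
  have hclean := (mem_CLEAN_iff tt sb y).1 hCLEAN
  have hrows := fun i hi => (mem_ROW_iff tt sb y i).1 ((mem_MAIN_iff _).1 hMAIN i hi)
  have hSP' := hSP.imp (mem_SIZE_iff tt sb y _ hsb).1 (mem_PROJ_iff tt sb y).1
  clear hWF hCANON hPOW hCLEAN hMAIN hSP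
  set n := (fstP y).length with hn
  set D := sndP y with hD
  set s := bitsToNat sb with hs
  -- the function tabulated by `tt`
  set f : (Fin n → Bool) → Bool := ofTruthTable tt hlen with hf
  have htf : truthTable f = tt := truthTable_ofTruthTable tt hlen
  rw [← htf, hsb]
  refine (boolPair_truthTable_mem_MCSP_iff f s).2 ?_
  -- the rows of `MAIN`
  have hrow : ∀ (i : ℕ) (hi : i < 2 ^ n),
      [tt[i]'(by omega)] = evalFn (boolPair (List.ofFn (lowBits n i)) D) := by
    intro i hi
    have hlt : i < (boolPair (boolPair tt sb) y).length := by
      simp only [length_boolPair]; omega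
    have hr := hrows i hlt
    have h1 : (tt.drop i).take 1 = [tt[i]'(by omega)] := by
      simpa using List.take_one_drop_eq_of_lt_length (show i < tt.length by omega)
    rw [h1] at hr
    exact hr.resolve_left (by simp)
  -- the value of `f` at a point, through the rows
  have hfv : ∀ v : Fin n → Bool, [f v] = evalFn (boolPair (List.ofFn v) D) := by
    intro v
    have hi := (boolFunEquivFin n v).isLt
    have hv : lowBits n (boolFunEquivFin n v) = v := by
      rw [← boolFunEquivFin_symm_apply, Equiv.symm_apply_apply]
    rw [← hv, ← hrow _ hi, hv]
    simp [hf, ofTruthTable]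
  rcases hSP' with hSIZE | hPROJ
  · -- `SIZE`: Theorem R
    obtain ⟨C, hB, hsize, hC⟩ := exists_circuit_evalFn n D hclean
    refine (circuitSizeOver_le_of_computes C hB fun v => ?_).trans (hsize.trans ?_)
    · simpa using ((hC v).symm.trans (hfv v).symm)
    · exact max_le hSIZE.1 (Nat.one_le_iff_ne_zero.2 hSIZE.2)
  · -- `PROJ`: a rotation code computes a projection
    obtain ⟨hones, hlen2⟩ := hPROJ
    have hrot : D = rotCode (D.length / 2) := eq_rotCode_of_isClean D.length D le_rfl hones hclean
    have hk : D.length / 2 < n := by omega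
    have hproj : ∀ v : Fin n → Bool, f v = v ⟨n - 1 - D.length / 2, by omega⟩ := by
      intro v
      have h1 := hfv v
      rw [hrot, evalFn_boolPair, vmSpec_rotCode_proj _ hk] at h1
      simpa using h1
    refine (circuitSizeOver_le_of_computes (Circuit.input ⟨n - 1 - D.length / 2, by omega⟩)
      (fun g hg => by simp [Circuit.input] at hg) fun v => ?_).trans (by simp)
    rw [Circuit.eval_input, hproj]

/-! ### Completeness -/

/-- The witness-length polynomial `96 m² + 64 m + 12`. [folklore] -/
noncomputable def wlen : Polynomial ℕ := 96 * Polynomial.X ^ 2 + 64 * Polynomial.X + 12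

/-- Evaluation of `wlen`. [folklore] -/
@[simp] theorem wlen_eval (m : ℕ) : wlen.eval m = 96 * m ^ 2 + 64 * m + 12 := by
  simp [wlen]

/-- `univBound n ≤ 5 · 2ⁿ - 4`. [cite: AroraBarakCC2009, Claim 2.13] -/
theorem univBound_le (n : ℕ) : univBound n + 4 ≤ 5 * 2 ^ n := by
  induction n with
  | zero => simp [univBound]
  | succ n ih => rw [univBound, pow_succ]; omega

/-- Gates of a `B₂`-circuit have arity `≤ 2`. [folklore] -/
theorem arity_le_of_isOver {n : ℕ} {C : Circuit (Fin n)} (hC : C.IsOver B2) : ∀ g ∈ C.gates, g.arity ≤ 2 :=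
  fun g hg => hC g hg

/-- All rows beyond the table are consistent, and so are the rows of a program computing `f`.
[cite: MurrayWilliams2015, §1 p. 365] -/
theorem mem_MAIN_of {n : ℕ} (f : (Fin n → Bool) → Bool) (sb D : List Bool)
    (hD : ∀ v : Fin n → Bool, evalFn (boolPair (List.ofFn v) D) = [f v]) :
    boolPair (boolPair (truthTable f) sb) (boolPair (ones n) D) ∈ MAIN := by
  rw [mem_MAIN_iff]
  intro i _
  rw [mem_ROW_iff]
  by_cases hi : i < 2 ^ n
  · right
    have hlen : (ones n).length = n := by simp [ones]
    rw [fstP_boolPair, sndP_boolPair, hlen, hD, List.take_one_drop_eq_of_lt_length (by simpa using hi),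
      List.get_eq_getElem, getElem_truthTable]
  · left
    rw [List.drop_of_length_le (by simp; omega)]
    rfl

/-- **Completeness of the verifier**: every `⟨tt f, bin s⟩ ∈ MCSP` has a short accepted
certificate — `⟨1ⁿ, rotCode (n-1-j)⟩` if an optimal circuit has no gate (then `f = x_j`), else
`⟨1ⁿ, progOf C⟩` for an optimal circuit `C`, of size `≤ univBound n < 3 |x|`
(`cktSize_univ_fin`), hence of length `≤ wlen |x|`. [cite: MurrayWilliams2015, §1 p. 365 and footnote 1] -/
theorem complete {n : ℕ} (f : (Fin n → Bool) → Bool) (s : ℕ) (hs : circuitSizeOver B2 f ≤ s) :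
    ∃ y : List Bool, y.length ≤ wlen.eval (boolPair (truthTable f) (encodeNat s)).length ∧
      boolPair (boolPair (truthTable f) (encodeNat s)) y ∈ Ver := by
  -- an optimal circuit, of size at most the universal bound
  obtain ⟨C₀, hB₀, hs₀, hC₀⟩ := (cktSize_univ_fin n fun v (_ : Unit) => f v).toCircuit
  obtain ⟨C, hB, hCf, hCs⟩ := exists_circuit_size_eq_circuitSizeOver ⟨C₀, hB₀, hC₀⟩
  have hCle : C.size ≤ s := hCs ▸ hs
  have hCu : C.size + 4 ≤ 5 * 2 ^ n :=
    (Nat.add_le_add_right ((hCs ▸ circuitSizeOver_le_of_computes C₀ hB₀ hC₀).trans hs₀) 4).trans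
      (univBound_le n)
  -- the instance
  set x := boolPair (truthTable f) (encodeNat s) with hx
  have hxl : 2 * 2 ^ n + 2 ≤ x.length := by simp [hx]
  have hn : n ≤ 2 ^ n := (Nat.lt_two_pow_self).le
  -- the common conditions
  have hWF : ∀ y, boolPair x y ∈ WF := fun y => (mem_WF_iff y x).2 (by simp [hx])
  have hCANON : ∀ y, boolPair x y ∈ CANON := fun y => (mem_CANON_iff _ _ y).2 (by simp)
  have hPOW : ∀ D, boolPair x (boolPair (ones n) D) ∈ POW := fun D =>
    (mem_POW_iff _ _ _).2 (by simp [ones])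
  by_cases h0 : C.size = 0
  · -- no gate: `f` is the projection to the output wire, an input
    have hg : C.gates = [] := List.eq_nil_of_length_eq_zero h0
    obtain ⟨j, hj⟩ : ∃ j : Fin n, C.output = .inl j := by
      cases ho : C.output with
      | inl j => exact ⟨j, rfl⟩
      | inr m => exact absurd (C.wf_output m ho) (by simp [hg])
    have hfj : ∀ v, f v = v j := fun v => by rw [← hCf v]; simp [Circuit.eval, hj]
    have hjn : (j : ℕ) < n := j.isLt
    set k := n - 1 - j with hk
    refine ⟨boolPair (ones n) (rotCode k), ?_, ?_⟩
    · simp only [length_boolPair, length_rotCode, wlen_eval, ones, List.length_replicate]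
      have hk' : k ≤ n := by omega
      nlinarith [hk', hn, hxl, Nat.zero_le (x.length ^ 2)]
    · refine ⟨⟨⟨⟨⟨hWF _, hCANON _⟩, hPOW _⟩, ?_⟩, ?_⟩, Or.inr ?_⟩
      · exact (mem_CLEAN_iff _ _ _).2 (by simp)
      · refine mem_MAIN_of f _ _ fun v => ?_
        rw [evalFn_boolPair, vmSpec_rotCode_proj k (by omega), hfj]
        congr 2
        exact Fin.ext (by simp [hk]; omega)
      · refine (mem_PROJ_iff _ _ _).2 ⟨?_, ?_⟩
        · simp only [sndP_boolPair, length_rotCode]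
          clear hk
          induction k with
          | zero => rfl
          | succ k ih => rw [rotCode, ih]; simp [ones, List.replicate_succ, Nat.mul_succ]
        · simp [ones]; omega
  · -- at least one gate: the program of `C`
    refine ⟨boolPair (ones n) (progOf C), ?_, ?_⟩
    · have hl := length_progOf_le C
      simp only [length_boolPair, wlen_eval, ones, List.length_replicate]
      have h1 : C.size ≤ 3 * x.length := by omega
      have h2 : (C.size + 1) * (8 * (n + C.size) + 10) ≤ (3 * x.length + 1) * (8 * (x.length + 3 * x.length) + 10) :=
        Nat.mul_le_mul (by omega) (by omega)
      have h3 : (3 * x.length + 1) * (8 * (x.length + 3 * x.length) + 10) = 96 * x.length ^ 2 + 62 * x.length + 10 := by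
        ring
      rw [h3] at h2
      omega
    · refine ⟨⟨⟨⟨⟨hWF _, hCANON _⟩, hPOW _⟩, ?_⟩, ?_⟩, Or.inl ?_⟩
      · exact (mem_CLEAN_iff _ _ _).2 (by simp)
      · refine mem_MAIN_of f _ _ fun v => ?_
        rw [evalFn_boolPair, vmSpec_progOf C (arity_le_of_isOver hB), hCf]
      · refine (mem_SIZE_iff _ _ _ s rfl).2 ⟨?_, by omega⟩
        simpa using hCle

/-! ### The discharge -/

end MCSPVerif

open MCSPVerif in
/-- **Discharge of the named fact `MCSP_mem_NP`** (`MCSP.lean`; Kabanets–Cai 2000, §2; the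
verifier spelled out in Murray–Williams 2015, §1, p. 365): `MCSP ∈ NP = ∃ᵖ·P` with the verifier
language `MCSPVerif.Ver ∈ P` (`Ver_mem_P`) and witness-length bound `wlen` — soundness `sound`,
completeness `complete`. [cite: KabanetsCai2000, §2] -/
theorem MCSP_mem_NP_holds : MCSP_mem_NP := by
  refine ⟨Ver, Ver_mem_P, wlen, fun x => ⟨fun hx => ?_, ?_⟩⟩
  · obtain ⟨n, f, s, rfl, hs⟩ := hx
    exact complete f s hs
  · rintro ⟨y, -, hy⟩
    exact sound x y hy

end Literature.Computability.MetaComplexity
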